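import Summits.MatrixMultiplication.OmegaCensus.STPPHamidouneRodsethThreeTwoRuns
import Summits.MatrixMultiplication.OmegaCensus.STPPHamidouneRodsethThreeTriple
import Summits.MatrixMultiplication.OmegaCensus.STPPVosperSlackOneLawCard

/-!
# ω-census (abelian STPP census): the Hamidoune–Rødseth inverse theorem for three-element sets — `HamidouneRodsethCard 3` PROVED (kernel)

HONEST FRAMING (pub-omega census; verbatim): lottery ticket; floor = certified bounds/negative ranges.
Census STRUCTURE / KERNEL desk (seat pub-omega-stpp-2 gen 24, 2026-08-28), family (b2).  This file DISCHARGES the named fact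
`CubeNB.HamidouneRodsethCard 3` of `STPPVosperSlackOneLawCard.lean` — the Hamidoune–Rødseth inverse theorem mod `p` for `|S| = 3`:
`|S| = 3`, `|T| ≥ 3`, `7 ≤ |S + T| ≤ p − 4`, `|S + T| ≤ |S| + |T|` ⇒ `S` lies in a 4-term and `T` in a `(|T|+1)`-term arithmetic progression
with ONE common difference — for every prime `p`, with no hypothesis left.  Consequently the three `ℤ₆₁` front leaves that
`STPPVosperSlackOneLawCard.lean` killed modulo `HamidouneRodsethCard 3` are killed UNCONDITIONALLY (`…_kernel` below).  Nothing here is progress on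
`ω`; these are exclusions of STPP patterns (OMEGA-TABLE NR257/NR258 bookkeeping: the two GO #91 leaves and `{(2,2,5),(2,4,3),(3,3,2)}` now read
engine ×1 + KERNEL).

## Proof route (NOT the paper's Davenport-transform proof; an elementary case analysis special to `|S| = 3`)

If `|S + T| ≤ |T| + 2` the pair is Vosper-critical (tree: `vosper_inverse`).  Otherwise `|S + T| = |T| + 3`; for a pair `{x, x+d} ⊆ S` the set
`T ∪ (d + T)` sits inside a translate of `S + T`, so `T` has at most three run-ends along `d`.  Normalise (`z ↦ d⁻¹(z − x)`) to `S = {0,1,v}`.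
If some pair of `S` sees at most two run-ends: `hr3_of_runs_le_two` (`STPPHamidouneRodsethThreeTwoRuns.lean`: Hamidoune–Rødseth's Lemma 1 for one
run; the two-run shift lemma `HR3.two_run_shape` for two).  If all three pairs see three run-ends: `hr3_of_all_runs_three`
(`STPPHamidouneRodsethThreeTriple.lean`: squeeze lemma or Vosper on `(S, T ∪ (1+T))`).  The case analysis was checked exhaustively for
`p ≤ 19` (all `T`) and the arithmetic lemma for all parameters with `p ≤ 30` before typing.

References: Y. O. Hamidoune, Ø. J. Rødseth, *An inverse theorem mod p*, Acta Arith. 92 (2000) 251–262, the theorem of the title (restated as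
Theorem 3 of O. Serra, G. Zémor, *On a generalization of a theorem by Vosper*, Integers 0 (2000) A10), case `|A| = 3`; A. G. Vosper, J. London Math.
Soc. 31 (1956); M. B. Nathanson, GTM 165, Thm 2.7; H. Cohn, R. Kleinberg, B. Szegedy, C. Umans, FOCS 2005, Def. 5.1 (the kills).
-/

open Finset
open scoped Pointwise

namespace Summit.MatrixMultiplication.OmegaCensus.HR3

open Literature.Combinatorics.Additive
open Literature.Combinatorics.Additive.Isoperimetric
open Literature.Computability.AlgebraicComplexity

variable {p : ℕ} [hp : Fact p.Prime]

/-! ## Normalisation: dilating `T` and reading an affine image of `S` -/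

/-- Dilation by a unit preserves cardinality. [folklore] -/
theorem card_image_mul {c : ZMod p} (hc : c ≠ 0) (T : Finset (ZMod p)) : #(T.image (c * ·)) = #T :=
  card_image_of_injective _ (mul_right_injective₀ hc)

/-- Run-ends of a dilate: `|(e + cT) ∖ cT| = |(c⁻¹e + T) ∖ T|`. [folklore] -/
theorem card_vadd_sdiff_image_mul {c : ZMod p} (hc : c ≠ 0) (T : Finset (ZMod p)) (e : ZMod p) :
    #((e +ᵥ T.image (c * ·)) \ T.image (c * ·)) = #(((c⁻¹ * e) +ᵥ T) \ T) := by
  have hinj : Function.Injective (fun z : ZMod p => c * z) := mul_right_injective₀ hc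
  have h1 : e +ᵥ T.image (c * ·) = ((c⁻¹ * e) +ᵥ T).image (c * ·) := by
    ext y
    simp only [mem_vadd_finset, mem_image, vadd_eq_add]
    constructor
    · rintro ⟨_, ⟨t, ht, rfl⟩, rfl⟩
      exact ⟨c⁻¹ * e + t, ⟨t, ht, rfl⟩, by rw [mul_add, ← mul_assoc, mul_inv_cancel₀ hc, one_mul]⟩
    · rintro ⟨_, ⟨t, ht, rfl⟩, rfl⟩
      exact ⟨c * t, ⟨t, ht, rfl⟩, by rw [mul_add, ← mul_assoc, mul_inv_cancel₀ hc, one_mul]⟩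
  rw [h1, ← image_sdiff _ _ hinj, card_image_of_injective _ hinj]

/-- The affine image of `S` plus the dilate of `T` is the affine image of `S + T`. [folklore] -/
theorem image_add_image_mul (c x : ZMod p) (S T : Finset (ZMod p)) :
    S.image (fun z => c * (z - x)) + T.image (c * ·) = (S + T).image (fun z => c * (z - x)) := by
  ext y
  simp only [Finset.mem_add, mem_image]
  constructor
  · rintro ⟨_, ⟨s, hs, rfl⟩, _, ⟨t, ht, rfl⟩, rfl⟩
    exact ⟨s + t, ⟨s, hs, t, ht, rfl⟩, by ring⟩
  · rintro ⟨_, ⟨s, hs, t, ht, rfl⟩, rfl⟩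
    exact ⟨_, ⟨s, hs, rfl⟩, _, ⟨t, ht, rfl⟩, by ring⟩

/-- Pulling a progression back through the dilation of `T`. [cite: Nathanson1996, §2.5] -/
theorem subset_apFinset_of_image_mul {c : ZMod p} (hc : c ≠ 0) {T : Finset (ZMod p)} {t e : ZMod p} {n : ℕ}
    (h : T.image (c * ·) ⊆ apFinset t e n) : T ⊆ apFinset (c⁻¹ * t) (c⁻¹ * e) n := by
  intro z hz
  obtain ⟨i, hi, hiz⟩ := mem_apFinset.1 (h (mem_image_of_mem _ hz))
  refine mem_apFinset.2 ⟨i, hi, ?_⟩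
  have : c⁻¹ * (t + i • e) = z := by rw [hiz, ← mul_assoc, inv_mul_cancel₀ hc, one_mul]
  rw [← this, mul_add, nsmul_eq_mul, nsmul_eq_mul]; ring

/-- Pulling a progression back through the affine image of `S`. [cite: Nathanson1996, §2.5] -/
theorem subset_apFinset_of_image_affine {c : ZMod p} (hc : c ≠ 0) (x : ZMod p) {S : Finset (ZMod p)} {s e : ZMod p} {n : ℕ}
    (h : S.image (fun z => c * (z - x)) ⊆ apFinset s e n) : S ⊆ apFinset (x + c⁻¹ * s) (c⁻¹ * e) n := by
  intro z hz
  obtain ⟨i, hi, hiz⟩ := mem_apFinset.1 (h (mem_image_of_mem _ hz))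
  refine mem_apFinset.2 ⟨i, hi, ?_⟩
  have : x + c⁻¹ * (s + i • e) = z := by rw [hiz, ← mul_assoc, inv_mul_cancel₀ hc, one_mul]; ring
  rw [← this, mul_add, nsmul_eq_mul, nsmul_eq_mul]; ring

/-- **Normalisation.**  For a base pair `{x, x + d} ⊆ S = {x, x+d, y}` (`d ≠ 0`, `y` the third point): with `c = d⁻¹`, `v = c(y − x)`,
`T' = cT`, the normalised data satisfy `v ≠ 0, 1`, `|T'| = |T|`, `|{0,1,v} + T'| = |S + T|`, the run counts of `T'` along `1`, `v`, `v − 1` are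
those of `T` along `d`, `y − x`, `y − x − d`, and progressions for `({0,1,v}, T')` pull back to progressions for `(S, T)` with a common
difference. [folklore] -/
theorem hr3_of_normalised {S T : Finset (ZMod p)} {x d y : ZMod p} (hd : d ≠ 0) (hyx : y ≠ x) (hyxd : y ≠ x + d)
    (hS : S = {x, x + d, y})
    (H : ∀ (v : ZMod p) (T' : Finset (ZMod p)), v ≠ 0 → v ≠ 1 → #T' = #T →
      #(({0, 1, v} : Finset (ZMod p)) + T') = #(S + T) →
      #(((1 : ZMod p) +ᵥ T') \ T') = #((d +ᵥ T) \ T) →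
      #((v +ᵥ T') \ T') = #(((y - x) +ᵥ T) \ T) →
      #(((v - 1) +ᵥ T') \ T') = #(((y - x - d) +ᵥ T) \ T) →
      ∃ e s t : ZMod p, ({0, 1, v} : Finset (ZMod p)) ⊆ apFinset s e 4 ∧ T' ⊆ apFinset t e (#T' + 1)) :
    ∃ e s t : ZMod p, S ⊆ apFinset s e 4 ∧ T ⊆ apFinset t e (#T + 1) := by
  set c : ZMod p := d⁻¹ with hc
  have hc0 : c ≠ 0 := inv_ne_zero hd
  have hcd : c * d = 1 := inv_mul_cancel₀ hd
  set v : ZMod p := c * (y - x) with hv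
  set T' : Finset (ZMod p) := T.image (c * ·) with hT'
  have hv0 : v ≠ 0 := by
    rw [hv]; exact mul_ne_zero hc0 (sub_ne_zero.2 hyx)
  have hv1 : v ≠ 1 := by
    intro h
    apply hyxd
    have : d * (c * (y - x)) = d * 1 := by rw [← hv, h]
    rw [← mul_assoc, mul_comm d c, hcd, one_mul, mul_one] at this
    linear_combination this
  have hSimg : S.image (fun z => c * (z - x)) = ({0, 1, v} : Finset (ZMod p)) := by
    rw [hS, image_insert, image_insert, image_singleton]
    congr 1
    · ring
    · congr 1
      rw [add_sub_cancel_left, hcd]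
  have hcardT : #T' = #T := card_image_mul hc0 T
  have hcardS : #(({0, 1, v} : Finset (ZMod p)) + T') = #(S + T) := by
    rw [← hSimg, hT', image_add_image_mul, card_image_of_injective]
    intro a b hab
    have := mul_right_injective₀ hc0 hab
    simpa using this
  have hruns : ∀ e : ZMod p, #((e +ᵥ T') \ T') = #(((d * e) +ᵥ T) \ T) := by
    intro e; rw [hT', card_vadd_sdiff_image_mul hc0, hc, inv_inv]
  obtain ⟨e, s, t, hS', hT''⟩ := H v T' hv0 hv1 hcardT hcardS
    (by rw [hruns, mul_one])
    (by rw [hruns, hv, ← mul_assoc, mul_comm d c, hcd, one_mul])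
    (by rw [hruns, hv, mul_sub, ← mul_assoc, mul_comm d c, hcd, one_mul, mul_one])
  refine ⟨c⁻¹ * e, x + c⁻¹ * s, c⁻¹ * t, ?_, ?_⟩
  · exact subset_apFinset_of_image_affine hc0 x (hSimg.symm ▸ hS')
  · rw [← hcardT]; exact subset_apFinset_of_image_mul hc0 hT''

/-! ## The theorem -/

/-- Translates of `T` by two points of `S` sit inside `S + T`: `T` has at most `|S + T| − |T|` run-ends along their difference. [folklore] -/
theorem card_vadd_sdiff_le_of_mem {S T : Finset (ZMod p)} {a b : ZMod p} (ha : a ∈ S) (hb : b ∈ S) :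
    #(((b - a) +ᵥ T) \ T) + #T ≤ #(S + T) := by
  classical
  have hsub : a +ᵥ (T ∪ ((b - a) +ᵥ T)) ⊆ S + T := by
    intro z hz
    rw [mem_vadd_finset] at hz
    obtain ⟨w, hw, rfl⟩ := hz
    rcases mem_union.1 hw with h | h
    · exact Finset.mem_add.2 ⟨a, ha, w, h, rfl⟩
    · obtain ⟨t, ht, rfl⟩ := mem_vadd_finset.1 h
      exact Finset.mem_add.2 ⟨b, hb, t, ht, by simp only [vadd_eq_add]; ring⟩
  have h1 := card_le_card hsub
  rw [card_vadd_finset] at h1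
  have h2 := card_sdiff_add_card ((b - a) +ᵥ T) T
  rw [union_comm] at h2
  omega

/-- **The Hamidoune–Rødseth inverse theorem for `|S| = 3` (all primes).**  `S, T ⊆ ℤ/pℤ`, `|S| = 3`, `|T| ≥ 3`, `7 ≤ |S + T| ≤ p − 4`,
`|S + T| ≤ |S| + |T|` ⇒ for some `d, s, t`: `S ⊆ {s, s+d, s+2d, s+3d}` and `T ⊆ {t, t+d, …, t + |T| d}`.
[cite: HamidouneRodseth2000, main theorem (§1, p. 252), case |A| = 3] [cite: SerraZemor2000, Theorem 3 (p. 2)] -/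
theorem hamidoune_rodseth_three {S T : Finset (ZMod p)} (hS3 : #S = 3) (hT3 : 3 ≤ #T) (h7 : 7 ≤ #(S + T))
    (hp4 : #(S + T) ≤ p - 4) (hle : #(S + T) ≤ #S + #T) :
    ∃ d s t : ZMod p, S ⊆ apFinset s d (#S + 1) ∧ T ⊆ apFinset t d (#T + 1) := by
  classical
  rw [hS3]
  obtain ⟨s₁, s₂, s₃, h12, h13, h23, hSeq⟩ := card_eq_three.1 hS3
  have hSne : S.Nonempty := ⟨s₁, by rw [hSeq]; simp⟩
  have hTne : T.Nonempty := card_pos.1 (by omega)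
  by_cases hcrit : #(S + T) ≤ #T + 2
  · -- Vosper-critical pair
    have hcd := ZMod.cauchy_davenport hp.out hSne hTne
    rw [hS3] at hcd
    have heq : #(S + T) = #S + #T - 1 := by
      rcases le_total p (3 + #T - 1) with h | h
      · rw [min_eq_left h] at hcd; omega
      · rw [min_eq_right h] at hcd; omega
    obtain ⟨d, -, ⟨a, hA⟩, ⟨b, hB⟩⟩ := vosper_inverse (A := S) (B := T) (by omega) (by omega) heq (by omega)
    rw [hS3] at hA
    exact ⟨d, a, b, hA.le.trans (apFinset_mono a d (by norm_num)), hB.le.trans (apFinset_mono b d (by omega))⟩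
  · have hsum : #(S + T) = #T + 3 := by omega
    have hTp : #T + 7 ≤ p := by omega
    have hT4 : 4 ≤ #T := by omega
    have hm1 : s₁ ∈ S := by rw [hSeq]; simp
    have hm2 : s₂ ∈ S := by rw [hSeq]; simp
    have hm3 : s₃ ∈ S := by rw [hSeq]; simp
    have hr12 := card_vadd_sdiff_le_of_mem (T := T) hm1 hm2
    have hr13 := card_vadd_sdiff_le_of_mem (T := T) hm1 hm3
    have hr23 := card_vadd_sdiff_le_of_mem (T := T) hm2 hm3
    by_cases hA : #(((s₂ - s₁) +ᵥ T) \ T) ≤ 2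
    · refine hr3_of_normalised (x := s₁) (d := s₂ - s₁) (y := s₃) (sub_ne_zero.2 h12.symm) h13.symm
        (by rw [add_sub_cancel]; exact h23.symm) (by rw [hSeq, add_sub_cancel]) ?_
      intro v T' hv0 hv1 hcT hcS hr1 _ _
      exact hr3_of_runs_le_two hv0 hv1 (by rw [hcT]; omega) (by rw [hcT]; omega) (by rw [hr1]; exact hA)
        (by rw [hcS, hsum, hcT])
    by_cases hB : #(((s₃ - s₁) +ᵥ T) \ T) ≤ 2
    · refine hr3_of_normalised (x := s₁) (d := s₃ - s₁) (y := s₂) (sub_ne_zero.2 h13.symm) h12.symm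
        (by rw [add_sub_cancel]; exact h23) (by rw [hSeq, add_sub_cancel, pair_comm]) ?_
      intro v T' hv0 hv1 hcT hcS hr1 _ _
      exact hr3_of_runs_le_two hv0 hv1 (by rw [hcT]; omega) (by rw [hcT]; omega) (by rw [hr1]; exact hB)
        (by rw [hcS, hsum, hcT])
    by_cases hC : #(((s₃ - s₂) +ᵥ T) \ T) ≤ 2
    · refine hr3_of_normalised (x := s₂) (d := s₃ - s₂) (y := s₁) (sub_ne_zero.2 h23.symm) h12
        (by rw [add_sub_cancel]; exact h13) (by rw [hSeq, add_sub_cancel, insert_comm, pair_comm]) ?_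
      intro v T' hv0 hv1 hcT hcS hr1 _ _
      exact hr3_of_runs_le_two hv0 hv1 (by rw [hcT]; omega) (by rw [hcT]; omega) (by rw [hr1]; exact hC)
        (by rw [hcS, hsum, hcT])
    -- all three pairs see three run-ends
    refine hr3_of_normalised (x := s₁) (d := s₂ - s₁) (y := s₃) (sub_ne_zero.2 h12.symm) h13.symm
      (by rw [add_sub_cancel]; exact h23.symm) (by rw [hSeq, add_sub_cancel]) ?_
    intro v T' hv0 hv1 hcT hcS hr1 hrv hrv1
    have e3 : s₃ - s₁ - (s₂ - s₁) = s₃ - s₂ := by ring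
    rw [e3] at hrv1
    exact hr3_of_all_runs_three hv0 hv1 (by rw [hcT]; omega) (by rw [hcT]; omega) (by rw [hr1]; omega)
      (by rw [hrv]; omega) (by rw [hrv1]; omega) (by rw [hcS, hsum, hcT])

/-- **`HamidouneRodsethCard 3` holds** — the named fact of `STPPVosperSlackOneLawCard.lean` (the Hamidoune–Rødseth inverse theorem mod `p`
restricted to `|S| = 3`), DISCHARGED for every prime. [cite: HamidouneRodseth2000, main theorem (§1, p. 252), case |A| = 3]
[cite: SerraZemor2000, Theorem 3 (p. 2)] -/
theorem hamidouneRodsethCard_three : CubeNB.HamidouneRodsethCard 3 := by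
  intro q _ S T hS hT h7 hp4 hle
  exact hamidoune_rodseth_three hS hT h7 hp4 hle

/-! ## The three `ℤ₆₁` leaves, unconditionally -/

/-- **`{(2,2,2),(2,3,3),(3,2,3),(3,3,2)}` has no STPP family in `ℤ₆₁`** — UNCONDITIONAL (was `…_of_hrCard3`; GO #91 leaf, OMEGA-TABLE NR257/NR258).
[cite: CohnKleinbergSzegedyUmans2005, Def. 5.1] [cite: HamidouneRodseth2000, main theorem (§1, p. 252)] -/
theorem no_isSTPP_zmod61_222_233_323_332_kernel (A B C : Fin 4 → Finset (ZMod 61)) (hS : IsSTPP A B C)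
    (hA : ∀ i, #(A i) = ![2, 2, 3, 3] i) (hB : ∀ i, #(B i) = ![2, 3, 2, 3] i) (hC : ∀ i, #(C i) = ![2, 3, 3, 2] i) : False :=
  CubeNB.no_isSTPP_zmod61_222_233_323_332_of_hrCard3 hamidouneRodsethCard_three A B C hS hA hB hC

/-- **`{(2,2,2),(2,3,3),(2,3,3),(3,2,3)}` has no STPP family in `ℤ₆₁`** — UNCONDITIONAL (was `…_of_hrCard3`; GO #91 leaf, OMEGA-TABLE NR257/NR258).
[cite: CohnKleinbergSzegedyUmans2005, Def. 5.1] [cite: HamidouneRodseth2000, main theorem (§1, p. 252)] -/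
theorem no_isSTPP_zmod61_222_233_233_323_kernel (A B C : Fin 4 → Finset (ZMod 61)) (hS : IsSTPP A B C)
    (hA : ∀ i, #(A i) = ![2, 2, 2, 3] i) (hB : ∀ i, #(B i) = ![2, 3, 3, 2] i) (hC : ∀ i, #(C i) = ![2, 3, 3, 3] i) : False :=
  CubeNB.no_isSTPP_zmod61_222_233_233_323_of_hrCard3 hamidouneRodsethCard_three A B C hS hA hB hC

/-- **`{(2,2,5),(2,4,3),(3,3,2)}` has no STPP family in `ℤ₆₁`** — UNCONDITIONAL (was `…_of_hrCard3`; OMEGA-TABLE NR255's neighbour on the `ℤ₆₁` front).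
[cite: CohnKleinbergSzegedyUmans2005, Def. 5.1] [cite: HamidouneRodseth2000, main theorem (§1, p. 252)] -/
theorem no_isSTPP_zmod61_225_243_332_kernel (A B C : Fin 3 → Finset (ZMod 61)) (hS : IsSTPP A B C)
    (hA : ∀ i, #(A i) = ![2, 2, 3] i) (hB : ∀ i, #(B i) = ![2, 4, 3] i) (hC : ∀ i, #(C i) = ![5, 3, 2] i) : False :=
  CubeNB.no_isSTPP_zmod61_225_243_332_of_hrCard3 hamidouneRodsethCard_three A B C hS hA hB hC

end Summit.MatrixMultiplication.OmegaCensus.HR3
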